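import Literature.MathematicalPhysics.QuantumFieldTheory.FiniteTemperatureTYLoopBounds
import HarnessLib

/-!
# Tomboulis–Yaffe at finite temperature, II: the Polyakov-loop pair at separation `L_s/2` is bounded by the
# temporal twist (TY 1985 App. I (A1.8), native setting `L_t ≠ L_s`)

E. T. Tomboulis and L. G. Yaffe, Commun. Math. Phys. **100** (1985) 313–341, App. I §C eq. (A1.8): the two-point function
of Polyakov loops at the maximal separation `L_s/2` is bounded by the electric-flux free energy, `G_{L_s/2} ≤ 2 exp(-F^{el}/2T)`,
`exp(-F^{el}/T) = ½(1 - Z⁻/Z)`, `Z⁻` 't Hooft's partition function with a twisted stack of (time, space) plaquettes.  The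
printed proof: "make a change of variables which flips the signs of the set of timelike links" (it moves the twisted stack
across one of the two Polyakov loops and multiplies its trace by the centre character), then reflection positivity in the
lattice planes containing the two loops, "considering both traces of the twist to be on opposite sides of the lattice from
`τ[S]`", and the cancellation of two opposite twists on homologous stacks.  The tree has this on the SYMMETRIC torus
(`TomboulisYaffeTwistBound.lean`); this file proves it in TY's native FINITE-TEMPERATURE setting on Borgs–Seiler's lattice
`FiniteTemperature.Config d L_t L_s G` (`L_s = 2n + 2 ≥ 4`, any `L_t`), for every compact `G`, continuous unitary `ρ`,
central `z` acting in `ρ` as a scalar `ω`, ANY real `J_E, J_M`: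

* `elecStackDiff ρ z i c U = Σ_{y : y_i = c} [Re tr ρ(z P_{(0,y)}^{(t,i)}) - Re tr ρ(P_{(0,y)}^{(t,i)})]` and the TWIST OBSERVABLE
  `stackTwistObs ρ J_E z i c = exp(J_E · elecStackDiff)`: multiplying the Boltzmann weight by it twists by `z` the electric
  coupling of the stack of `(time, i)` plaquettes based at `{t = 0, x_i = c}` ('t Hooft's twisted action for the temporal
  plane `(i, time)`; `weight · stackTwistObs` integrates to the twisted partition function `Z⁻`);
* `stackMul i g` — left-multiplication of the time-like links `{((0, y), time) : y_i = 0}` by a central `g` (TY's change of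
  variables); `plaquette_stackMul_none`, ★ `weight_stackMul` (`e^{-S(Φ_g U)} = e^{-S(U)} T_{0,g}(U) T_{-1,g⁻¹}(U)`: the move
  creates opposite twists on the two adjacent stacks), `stackTwistObs_stackMul_*`, `polyakovTrace_stackMul_*`,
  `measurePreserving_stackMul`; ★ `integral_comp_stackMul_twist` (the composition rule
  `∫ F(Φ_g U) T_{0,z₀}(Φ_g U) T_{-1,z₁}(Φ_g U) e^{-S(Φ_g U)} = …` in the form used below);
* `elecStackDiff_spaceSiteReflect` — the site reflection in the planes `x_i = 0, L_s/2` carries the stack at `x_i = c` to the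
  one at `x_i = -1-c` with the twist INVERTED (Kanazawa's (15): "the orientation of plaquettes are reversed by reflection");
* ★★ `normSq_integral_polyakov_pair_mul_one_sub_twist_le` — the Cauchy–Schwarz step: for central `z`,
  `|∫ tr ρ(P_{x₀}) conj tr ρ(P_{x₁}) (1 - T_{-1,z}) e^{-S}|² ≤ 2 N⁴ Z (Z - Z⁻_z)` (`x₀`, `x₁` in the planes `x_i = 0`, `x_i = L_s/2`);
* ★★★ `normSq_integral_polyakov_pair_le_twist` — TY (A1.8) at finite temperature:
  `|1 - ω|² |∫ tr ρ(P_{x₀}) conj tr ρ(P_{x₁}) e^{-S}|² ≤ 8 N⁴ Z (Z - Z⁻_z)`, `Z⁻_z = ∫ T_{0,z} e^{-S}`, together with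
  `Z⁻_z ≤ Z` (`integral_stackTwistObs_mul_weight_le`).

Everything is proved.  HONEST FRAMING: finite-volume inequalities at fixed couplings; no statement about `β → ∞`, confinement
or a mass gap.  The assembled Tomboulis–Yaffe inequality (plaquette ↦ twist) is in the sequel.

References: E. T. Tomboulis, L. G. Yaffe, Commun. Math. Phys. 100 (1985) 313–341, §II (2.8)–(2.10), App. I §C (A1.8)
[TomboulisYaffe1985]; T. Kanazawa, Ann. Phys. 324 (2009) 1634, §2 Lemma 1 (11), Lemma 2 (15)–(18) [Kanazawa2008]; G. 't Hooft,
Nucl. Phys. B 153 (1979) 141, §2.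
-/

noncomputable section

open MeasureTheory Filter Topology Finset
open scoped ComplexConjugate ComplexOrder BigOperators

namespace Literature.Barriers.QuantumFields

namespace FiniteTemperature

open Literature.MathematicalPhysics.QuantumFieldTheory

/-! ### The twist observable of a temporal stack and the stack-moving change of variables: algebra -/

section Algebra

variable {d L₀ L : ℕ} {G : Type*} [Group G] {N : ℕ}

/-- The factor picked up by the time-like link at the site `x` under the stack move: `g` on `{t = 0, x_i = 0}`, else `1`.
[cite: TomboulisYaffe1985, App. I §C (A1.8) ("a change of variables which flips the signs of the set of timelike links")] -/
def stackFactor (i : Fin d) (g : G) (x : Site d L₀ L) : G := if x.1 = 0 ∧ x.2 i = 0 then g else 1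

/-- **The stack move**: left-multiply the time-like link variables `((0, y), time)` with `y_i = 0` by `g`.
[cite: TomboulisYaffe1985, App. I §C (A1.8)] [cite: Kanazawa2008, §2 Lemma 1 eq. (11)] -/
def stackMul (i : Fin d) (g : G) (U : Config d L₀ L G) : Config d L₀ L G :=
  fun e => (if e.2 = none then stackFactor i g e.1 else 1) * U e

/-- The stack move on time-like links. [cite: TomboulisYaffe1985, App. I §C (A1.8)] -/
@[simp] theorem stackMul_apply_none (i : Fin d) (g : G) (U : Config d L₀ L G) (x : Site d L₀ L) :
    stackMul i g U (x, none) = stackFactor i g x * U (x, none) := by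
  simp [stackMul]

/-- The stack move does not touch space-like links. [cite: TomboulisYaffe1985, App. I §C (A1.8)] -/
@[simp] theorem stackMul_apply_some (i : Fin d) (g : G) (U : Config d L₀ L G) (x : Site d L₀ L) (j : Fin d) :
    stackMul i g U (x, some j) = U (x, some j) := by
  simp [stackMul]

/-- Spatial plaquettes are unchanged by the stack move. [cite: TomboulisYaffe1985, App. I §C (A1.8)] -/
theorem plaquette_stackMul_some_some (i : Fin d) (g : G) (U : Config d L₀ L G) (x : Site d L₀ L) (j k : Fin d) :
    plaquette (stackMul i g U) x (some j) (some k) = plaquette U x (some j) (some k) := by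
  simp [plaquette, Site.shift]

/-- **Temporal plaquettes under the stack move** (central `g`): the `(time, j)` plaquette at `x` picks up the central factor
`c(x) c(x + e_j)⁻¹`, `c` = `stackFactor`. [cite: TomboulisYaffe1985, App. I §C (A1.8)] [cite: Kanazawa2008, §2 Lemma 1 eq. (11)] -/
theorem plaquette_stackMul_none (i : Fin d) {g : G} (hg : g ∈ Subgroup.center G) (U : Config d L₀ L G) (x : Site d L₀ L)
    (j : Fin d) :
    plaquette (stackMul i g U) x none (some j) =
      stackFactor i g x * (stackFactor i g (x.shift (some j)))⁻¹ * plaquette U x none (some j) := by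
  have hc : ∀ y : Site d L₀ L, stackFactor i g y ∈ Subgroup.center G := fun y => by
    unfold stackFactor; split_ifs
    · exact hg
    · exact Subgroup.one_mem _
  simp only [plaquette, stackMul_apply_none, stackMul_apply_some, mul_inv_rev]
  have h1 := Subgroup.mem_center_iff.1 (hc x)
  have h2 := Subgroup.mem_center_iff.1 (Subgroup.inv_mem _ (hc (x.shift (some j))))
  -- move the two central factors to the front
  calc stackFactor i g x * U (x, none) * U (x.shift none, some j) *
        ((U (x.shift (some j), none))⁻¹ * (stackFactor i g (x.shift (some j)))⁻¹) * (U (x, some j))⁻¹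
      = stackFactor i g x * ((stackFactor i g (x.shift (some j)))⁻¹ * (U (x, none) * U (x.shift none, some j) *
          (U (x.shift (some j), none))⁻¹)) * (U (x, some j))⁻¹ := by rw [← h2]; simp only [mul_assoc]
    _ = _ := by simp only [mul_assoc]

variable (ρ : G →* Matrix (Fin N) (Fin N) ℂ)

/-- **The electric twist of one stack**: `Σ_{y : y_i = c} [Re tr ρ(z P) - Re tr ρ(P)]` over the `(time, i)` plaquettes `P`
based at `{t = 0, x_i = c}` (the exponent of 't Hooft's twisted action minus the untwisted one, divided by `J_E`).
[cite: TomboulisYaffe1985, §II eq. (2.8) (p. 316)] [cite: tHooft1979Flux, §2 (2.5)–(2.6)] -/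
def elecStackDiff [NeZero L] (z : G) (i : Fin d) (c : ZMod L) (U : Config d L₀ L G) : ℝ :=
  ∑ y : Fin d → ZMod L, if y i = c then
    ((ρ (z * plaquette U (0, y) none (some i))).trace.re - (ρ (plaquette U (0, y) none (some i))).trace.re) else 0

/-- **The twist observable** `T_{c,z} = exp(J_E · elecStackDiff)`: `e^{-S} · T_{c,z}` is the Boltzmann weight with the stack at
`{t = 0, x_i = c}` twisted by `z` (TY's `τ[S]` inserted into the measure, Kanazawa's `𝒪^{[k]}[𝒱]`).
[cite: TomboulisYaffe1985, §II eq. (2.8) (p. 316)] [cite: Kanazawa2008, §2 eq. (12)] -/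
def stackTwistObs [NeZero L] (JE : ℝ) (z : G) (i : Fin d) (c : ZMod L) (U : Config d L₀ L G) : ℝ :=
  Real.exp (JE * elecStackDiff ρ z i c U)

/-- No twist: `elecStackDiff 1 = 0`. [cite: Kanazawa2008, §2 Lemma 1 eq. (11)] -/
@[simp] theorem elecStackDiff_one [NeZero L] (i : Fin d) (c : ZMod L) (U : Config d L₀ L G) :
    elecStackDiff ρ 1 i c U = 0 := by
  simp [elecStackDiff]

/-- No twist: `T_{c,1} = 1`. [cite: Kanazawa2008, §2 Lemma 1 eq. (11)] -/
@[simp] theorem stackTwistObs_one [NeZero L] (JE : ℝ) (i : Fin d) (c : ZMod L) (U : Config d L₀ L G) :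
    stackTwistObs ρ JE 1 i c U = 1 := by
  simp [stackTwistObs]

/-- The twist observable is positive. [cite: Kanazawa2008, §2 eq. (12)] -/
theorem stackTwistObs_pos [NeZero L] (JE : ℝ) (z : G) (i : Fin d) (c : ZMod L) (U : Config d L₀ L G) :
    0 < stackTwistObs ρ JE z i c U := Real.exp_pos _

/-- **The electric slices under the stack move** (central `g`, `-1 ≠ 0` in `ℤ/L`): the slice `t = 0` picks up the twists `g` on the
stack `x_i = 0` and `g⁻¹` on the stack `x_i = -1`; the other slices are unchanged.
[cite: TomboulisYaffe1985, App. I §C (A1.8)] [cite: Kanazawa2008, §2 Lemma 1 eq. (11)] -/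
theorem elecSlice_stackMul [NeZero L₀] [NeZero L] (hL : (-1 : ZMod L) ≠ 0) (i : Fin d) {g : G}
    (hg : g ∈ Subgroup.center G) (U : Config d L₀ L G) (t : ZMod L₀) :
    elecSlice ρ t (stackMul i g U) = elecSlice ρ t U +
      if t = 0 then elecStackDiff ρ g i 0 U + elecStackDiff ρ g⁻¹ i (-1) U else 0 := by
  have h1' : (1 : ZMod L) ≠ 0 := fun h => hL (neg_eq_zero.2 h)
  unfold elecSlice
  simp_rw [plaquette_stackMul_none i hg]
  by_cases ht : t = 0
  · subst ht
    rw [if_pos rfl]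
    unfold elecStackDiff
    rw [← Finset.sum_add_distrib, ← Finset.sum_add_distrib]
    refine Finset.sum_congr rfl fun y _ => ?_
    -- the summand, direction by direction
    have hterm : ∀ j : Fin d,
        (ρ (stackFactor i g ((0 : ZMod L₀), y) * (stackFactor i g (Site.shift ((0 : ZMod L₀), y) (some j)))⁻¹ *
            plaquette U (0, y) none (some j))).trace.re =
          (ρ (plaquette U (0, y) none (some j))).trace.re +
            if j = i then
              ((if y i = 0 then ((ρ (g * plaquette U (0, y) none (some i))).trace.re -
                  (ρ (plaquette U (0, y) none (some i))).trace.re) else 0) +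
               (if y i = -1 then ((ρ (g⁻¹ * plaquette U (0, y) none (some i))).trace.re -
                  (ρ (plaquette U (0, y) none (some i))).trace.re) else 0))
            else 0 := by
      intro j
      by_cases hj : j = i
      · subst hj
        rw [if_pos rfl]
        have hsf0 : stackFactor j g ((0 : ZMod L₀), y) = if y j = 0 then g else 1 := by simp [stackFactor]
        have hsf1 : stackFactor j g (Site.shift ((0 : ZMod L₀), y) (some j)) = if y j + 1 = 0 then g else 1 := by
          simp [stackFactor, Site.shift]
        rw [hsf0, hsf1]
        by_cases h0 : y j = 0
        · have h1 : ¬ (y j + 1 = 0) := by rw [h0, zero_add]; exact h1'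
          have h2 : ¬ y j = -1 := by rw [h0]; exact fun h => hL h.symm
          rw [if_pos h0, if_neg h1, if_pos h0, if_neg h2, inv_one, mul_one, add_zero]
          ring
        · by_cases h2 : y j = -1
          · have h1 : y j + 1 = 0 := by rw [h2]; ring
            rw [if_neg h0, if_pos h1, if_neg h0, if_pos h2, one_mul, zero_add]
            ring
          · have h3 : ¬ (y j + 1 = 0) := fun h => h2 (by linear_combination h)
            rw [if_neg h0, if_neg h3, if_neg h0, if_neg h2, inv_one, mul_one, one_mul, add_zero, add_zero]
      · have hij : i ≠ j := fun h => hj h.symm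
        have hsf : stackFactor i g ((0 : ZMod L₀), y) = stackFactor i g (Site.shift ((0 : ZMod L₀), y) (some j)) := by
          simp [stackFactor, Site.shift, Pi.single_eq_of_ne hij]
        rw [hsf, mul_inv_cancel, one_mul, if_neg hj, add_zero]
    simp_rw [hterm]
    rw [Finset.sum_add_distrib, Finset.sum_ite_eq' Finset.univ i, if_pos (Finset.mem_univ _)]
  · rw [if_neg ht, add_zero]
    refine Finset.sum_congr rfl fun y _ => Finset.sum_congr rfl fun j _ => ?_
    have h1 : stackFactor i g (t, y) = 1 := by simp [stackFactor, ht]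
    have h2 : stackFactor i g (Site.shift (t, y) (some j)) = 1 := by simp [stackFactor, Site.shift, ht]
    rw [h1, h2, inv_one, one_mul, one_mul]

/-- **The Boltzmann weight under the stack move**: `e^{-S(Φ_g U)} = e^{-S(U)} · T_{0,g}(U) · T_{-1,g⁻¹}(U)` — the change of variables
creates the twist `g` on the stack `x_i = 0` and the opposite twist on the adjacent stack `x_i = -1` (central `g`).
[cite: TomboulisYaffe1985, App. I §C (A1.8)] [cite: Kanazawa2008, §2 Lemma 1 eq. (11)] -/
theorem weight_stackMul [NeZero L₀] [NeZero L] (hL : (-1 : ZMod L) ≠ 0) (JE JM : ℝ) (i : Fin d) {g : G}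
    (hg : g ∈ Subgroup.center G) (U : Config d L₀ L G) :
    weight ρ JE JM (stackMul i g U) = weight ρ JE JM U * stackTwistObs ρ JE g i 0 U * stackTwistObs ρ JE g⁻¹ i (-1) U := by
  unfold weight stackTwistObs
  rw [← Real.exp_add, ← Real.exp_add, minusAction_eq_sum_slices, minusAction_eq_sum_slices]
  congr 1
  have hmag : ∀ t, magSlice ρ t (stackMul i g U) = magSlice ρ t U := fun t => by
    unfold magSlice; simp_rw [plaquette_stackMul_some_some]
  simp_rw [hmag, elecSlice_stackMul ρ hL i hg U]
  rw [Finset.sum_add_distrib, Finset.sum_ite_eq' Finset.univ (0 : ZMod L₀), if_pos (Finset.mem_univ _)]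
  ring

/-- **The twist observables under the stack move** (central `g, z`): on the stack `x_i = 0` the plaquettes pick up `g`, so
`elecStackDiff z 0 (Φ_g U) = elecStackDiff (z g) 0 U - elecStackDiff g 0 U`. [cite: Kanazawa2008, §2 Lemma 1 eq. (11)] -/
theorem elecStackDiff_stackMul_zero [NeZero L] (hL : (-1 : ZMod L) ≠ 0) (i : Fin d) {g z : G}
    (hg : g ∈ Subgroup.center G) (U : Config d L₀ L G) :
    elecStackDiff ρ z i 0 (stackMul i g U) = elecStackDiff ρ (z * g) i 0 U - elecStackDiff ρ g i 0 U := by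
  unfold elecStackDiff
  rw [← Finset.sum_sub_distrib]
  refine Finset.sum_congr rfl fun y _ => ?_
  have h1' : (1 : ZMod L) ≠ 0 := fun h => hL (neg_eq_zero.2 h)
  by_cases h0 : y i = 0
  · rw [if_pos h0, if_pos h0, if_pos h0, plaquette_stackMul_none i hg]
    simp [stackFactor, Site.shift, h0, h1', mul_assoc]
  · rw [if_neg h0, if_neg h0, if_neg h0, sub_zero]

/-- On the stack `x_i = -1` the plaquettes pick up `g⁻¹`:
`elecStackDiff z (-1) (Φ_g U) = elecStackDiff (z g⁻¹) (-1) U - elecStackDiff g⁻¹ (-1) U`. [cite: Kanazawa2008, §2 Lemma 1 eq. (11)] -/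
theorem elecStackDiff_stackMul_neg_one [NeZero L] (hL : (-1 : ZMod L) ≠ 0) (i : Fin d) {g z : G}
    (hg : g ∈ Subgroup.center G) (U : Config d L₀ L G) :
    elecStackDiff ρ z i (-1) (stackMul i g U) = elecStackDiff ρ (z * g⁻¹) i (-1) U - elecStackDiff ρ g⁻¹ i (-1) U := by
  unfold elecStackDiff
  rw [← Finset.sum_sub_distrib]
  refine Finset.sum_congr rfl fun y _ => ?_
  by_cases h0 : y i = -1
  · rw [if_pos h0, if_pos h0, if_pos h0, plaquette_stackMul_none i hg]
    simp [stackFactor, Site.shift, h0, hL, mul_assoc]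
  · rw [if_neg h0, if_neg h0, if_neg h0, sub_zero]

/-- **The composition rule for twists under the stack move** (central `g, z₀, z₁`): pointwise,
`e^{-S(Φ_g U)} T_{0,z₀}(Φ_g U) T_{-1,z₁}(Φ_g U) = e^{-S(U)} T_{0,z₀ g}(U) T_{-1,z₁ g⁻¹}(U)` — Kanazawa's
`⟨𝒪^{[k]} 𝒪^{[k']}⟩ = ⟨𝒪^{[k+k']}⟩` for the two stacks at once. [cite: Kanazawa2008, §2 Lemma 1 eq. (11)] [cite: TomboulisYaffe1985, App. I §C (A1.8)] -/
theorem weight_mul_twist_stackMul [NeZero L₀] [NeZero L] (hL : (-1 : ZMod L) ≠ 0) (JE JM : ℝ) (i : Fin d)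
    {g z₀ z₁ : G} (hg : g ∈ Subgroup.center G) (U : Config d L₀ L G) :
    weight ρ JE JM (stackMul i g U) * stackTwistObs ρ JE z₀ i 0 (stackMul i g U) *
        stackTwistObs ρ JE z₁ i (-1) (stackMul i g U) =
      weight ρ JE JM U * stackTwistObs ρ JE (z₀ * g) i 0 U * stackTwistObs ρ JE (z₁ * g⁻¹) i (-1) U := by
  rw [weight_stackMul ρ hL JE JM i hg]
  unfold stackTwistObs weight
  rw [elecStackDiff_stackMul_zero ρ hL i hg, elecStackDiff_stackMul_neg_one ρ hL i hg]
  simp only [← Real.exp_add]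
  congr 1
  ring

/-- **Polyakov loops under the stack move**: a loop through the plane `x_i = 0` is multiplied by `g` (its first link is moved).
[cite: TomboulisYaffe1985, App. I §C (A1.8)] -/
theorem polyakovLine_stackMul_of_eq [NeZero L₀] (i : Fin d) (g : G) (U : Config d L₀ L G) {x : Fin d → ZMod L}
    (hx : x i = 0) : polyakovLine (stackMul i g U) x = g * polyakovLine U x := by
  obtain ⟨k, hk⟩ := Nat.exists_eq_succ_of_ne_zero (NeZero.ne L₀)
  subst hk
  have htail : timeHolonomy (stackMul i g U) k ((1 : ZMod (k + 1)), x) = timeHolonomy U k (1, x) := by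
    refine timeHolonomy_congr k 1 x fun j hj => ?_
    rw [stackMul_apply_none]
    have hne : ((1 : ZMod (k + 1)) + (j : ℕ)) ≠ 0 := by
      rw [show ((1 : ZMod (k + 1)) + (j : ℕ)) = ((1 + j : ℕ) : ZMod (k + 1)) by push_cast; ring, ne_eq,
        ZMod.natCast_eq_zero_iff]
      intro hdvd
      have := Nat.le_of_dvd (by omega) hdvd
      omega
    simp [stackFactor, hne]
  have hstep : ∀ V : Config d (k + 1) L G, timeHolonomy V (k + 1) ((0 : ZMod (k + 1)), x) =
      V (((0 : ZMod (k + 1)), x), none) * timeHolonomy V k (1, x) := by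
    intro V
    show V (((0 : ZMod (k + 1)), x), none) * timeHolonomy V k (Site.shift ((0 : ZMod (k + 1)), x) none) = _
    simp [Site.shift]
  unfold polyakovLine
  rw [hstep, hstep, stackMul_apply_none, htail]
  simp [stackFactor, hx, mul_assoc]

/-- A Polyakov loop off the plane `x_i = 0` is unchanged by the stack move. [cite: TomboulisYaffe1985, App. I §C (A1.8)] -/
theorem polyakovLine_stackMul_of_ne (i : Fin d) (g : G) (U : Config d L₀ L G) {x : Fin d → ZMod L}
    (hx : x i ≠ 0) : polyakovLine (stackMul i g U) x = polyakovLine U x := by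
  unfold polyakovLine
  refine timeHolonomy_congr L₀ 0 x fun j hj => ?_
  rw [stackMul_apply_none]
  simp [stackFactor, hx]

/-- `Re tr ρ(z · v⁻¹ P⁻¹ v) = Re tr ρ(z⁻¹ P)` for central `z` and unitary `ρ` (the twist read through a reflection is inverted).
[cite: Kanazawa2008, §2 Lemma 2 eq. (15)] -/
theorem trace_re_rep_mul_conj_inv (hρu : ∀ g, ρ g ∈ Matrix.unitaryGroup (Fin N) ℂ) {z : G} (hz : z ∈ Subgroup.center G)
    (v P : G) : (ρ (z * (v⁻¹ * P⁻¹ * v))).trace.re = (ρ (z⁻¹ * P)).trace.re := by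
  have hzc := Subgroup.mem_center_iff.1 hz
  have h1 : z * (v⁻¹ * P⁻¹ * v) = v⁻¹ * (z * P⁻¹) * v := by
    rw [show z * (v⁻¹ * P⁻¹ * v) = z * v⁻¹ * P⁻¹ * v by simp only [mul_assoc], ← hzc v⁻¹]
    simp only [mul_assoc]
  rw [h1, trace_re_rep_conj, ← trace_re_rep_inv ρ hρu, mul_inv_rev, inv_inv]
  have h2 : P * z⁻¹ = z⁻¹ * P := by
    have := hzc (P * z⁻¹)
    -- `z` central: `z⁻¹` central
    calc P * z⁻¹ = z⁻¹ * (z * (P * z⁻¹)) := by rw [← mul_assoc, inv_mul_cancel, one_mul]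
      _ = z⁻¹ * ((P * z⁻¹) * z) := by rw [hzc]
      _ = z⁻¹ * P := by rw [mul_assoc, inv_mul_cancel, mul_one]
  rw [h2]

/-- The map `y ↦ σ(y + e_i)` (`σ` the site reflection of the `i`-th coordinate) is an involution of the spatial sites; it carries
the stack condition `y_i = c` to `y_i = -1 - c`. [cite: Kanazawa2008, §2 Lemma 2 eq. (15)] -/
theorem siteRefl_add_single_involutive (i : Fin d) :
    Function.Involutive (fun y : Fin d → ZMod L => siteRefl i (y + Pi.single i 1)) := by
  intro y
  funext j
  by_cases hj : j = i
  · subst hj; simp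
  · simp [hj]

/-- **The twist read through the site reflection**: `elecStackDiff z c (σU) = elecStackDiff z⁻¹ (-1 - c) U` — the reflection in
the lattice planes `x_i = 0, L/2` carries the stack at `x_i = c` onto the stack at `x_i = -1 - c` and REVERSES the orientation of its
plaquettes (central `z`, unitary `ρ`). [cite: Kanazawa2008, §2 Lemma 2 eq. (15)] [cite: TomboulisYaffe1985, App. I §C (A1.8)] -/
theorem elecStackDiff_spaceSiteReflect [NeZero L] (hρu : ∀ g, ρ g ∈ Matrix.unitaryGroup (Fin N) ℂ) (i : Fin d) {z : G}
    (hz : z ∈ Subgroup.center G) (c : ZMod L) (U : Config d L₀ L G) :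
    elecStackDiff ρ z i c (spaceSiteReflect i U) = elecStackDiff ρ z⁻¹ i (-1 - c) U := by
  unfold elecStackDiff
  have hpl : ∀ y : Fin d → ZMod L, plaquette (spaceSiteReflect i U) (0, y) none (some i) =
      (U ((0, siteRefl i (y + Pi.single i 1)), some i))⁻¹ *
        (plaquette U (0, siteRefl i (y + Pi.single i 1)) none (some i))⁻¹ * U ((0, siteRefl i (y + Pi.single i 1)), some i) := by
    intro y
    rw [spaceSiteReflect, plaquette_translate, siteShift_apply, plaquette_spaceReflect_none_same]
  set e : (Fin d → ZMod L) → Fin d → ZMod L := fun y => siteRefl i (y + Pi.single i 1) with he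
  have hinv : Function.Involutive e := siteRefl_add_single_involutive i
  have hei : ∀ y, e y i = -1 - y i := fun y => by simp [he]; ring
  -- rewrite the summand through `e` and reindex
  have hsum : ∀ y : Fin d → ZMod L,
      (if y i = c then ((ρ (z * plaquette (spaceSiteReflect i U) (0, y) none (some i))).trace.re -
        (ρ (plaquette (spaceSiteReflect i U) (0, y) none (some i))).trace.re) else 0) =
      (if e y i = -1 - c then ((ρ (z⁻¹ * plaquette U (0, e y) none (some i))).trace.re -
        (ρ (plaquette U (0, e y) none (some i))).trace.re) else 0) := by
    intro y
    have hcond : (y i = c) ↔ (e y i = -1 - c) := by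
      rw [hei]; constructor
      · intro h; rw [h]
      · intro h; linear_combination -h
    by_cases hy : y i = c
    · rw [if_pos hy, if_pos (hcond.1 hy), hpl y, trace_re_rep_mul_conj_inv ρ hρu hz]
      have h1 := trace_re_rep_mul_conj_inv ρ hρu (Subgroup.one_mem _) (U ((0, e y), some i))
        (plaquette U (0, e y) none (some i))
      rw [one_mul, inv_one, one_mul] at h1
      rw [h1]
    · rw [if_neg hy, if_neg (fun h => hy (hcond.2 h))]
  simp_rw [hsum]
  exact Equiv.sum_comp hinv.toPerm (fun w => if w i = -1 - c then ((ρ (z⁻¹ * plaquette U (0, w) none (some i))).trace.re -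
    (ρ (plaquette U (0, w) none (some i))).trace.re) else 0)

/-- Hence `T_{c,z}(σU) = T_{-1-c, z⁻¹}(U)`. [cite: Kanazawa2008, §2 Lemma 2 eq. (15)] -/
theorem stackTwistObs_spaceSiteReflect [NeZero L] (hρu : ∀ g, ρ g ∈ Matrix.unitaryGroup (Fin N) ℂ) (JE : ℝ) (i : Fin d)
    {z : G} (hz : z ∈ Subgroup.center G) (c : ZMod L) (U : Config d L₀ L G) :
    stackTwistObs ρ JE z i c (spaceSiteReflect i U) = stackTwistObs ρ JE z⁻¹ i (-1 - c) U := by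
  unfold stackTwistObs; rw [elecStackDiff_spaceSiteReflect ρ hρu i hz]

end Algebra

/-! ### Measure, continuity, dependence -/

section Measure

variable {d L₀ n : ℕ} [NeZero L₀] {G : Type*} [Group G] [TopologicalSpace G] [IsTopologicalGroup G]
  [CompactSpace G] [MeasurableSpace G] [BorelSpace G] {N : ℕ}
variable (ρ : G →* Matrix (Fin N) (Fin N) ℂ)

omit [TopologicalSpace G] [IsTopologicalGroup G] [CompactSpace G] [MeasurableSpace G] [BorelSpace G] [NeZero L₀] ρ in
/-- Two stack moves compose; the trivial move is the identity. [cite: Kanazawa2008, §2 Lemma 1 eq. (11)] -/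
theorem stackMul_stackMul {L : ℕ} (i : Fin d) (a b : G) (U : Config d L₀ L G) :
    stackMul i a (stackMul i b U) = stackMul i (a * b) U := by
  funext e
  rcases e with ⟨x, _ | j⟩
  · simp only [stackMul_apply_none, stackFactor]
    split_ifs <;> simp [mul_assoc]
  · simp

omit [TopologicalSpace G] [IsTopologicalGroup G] [CompactSpace G] [MeasurableSpace G] [BorelSpace G] [NeZero L₀] ρ in
/-- The trivial stack move. [cite: Kanazawa2008, §2 Lemma 1 eq. (11)] -/
theorem stackMul_one {L : ℕ} (i : Fin d) (U : Config d L₀ L G) : stackMul i (1 : G) U = U := by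
  funext e
  rcases e with ⟨x, _ | j⟩
  · simp [stackFactor]
  · simp

omit ρ in
/-- **The stack move preserves the a-priori measure** (left invariance of the Haar measure, factor by factor).
[cite: Kanazawa2008, §2 Lemma 1 eq. (11)] -/
theorem measurePreserving_stackMul {L : ℕ} [NeZero L] (i : Fin d) (g : G) :
    MeasurePreserving (stackMul (d := d) (L₀ := L₀) (L := L) i g) (haar d L₀ L G) (haar d L₀ L G) := by
  haveI : (haarProbability G).IsMulLeftInvariant := by
    dsimp [Literature.MathematicalPhysics.QuantumFieldTheory.haarProbability]; infer_instance
  unfold haar stackMul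
  exact measurePreserving_pi _ _ (fun e => measurePreserving_mul_left _ _)

omit ρ in
/-- **Change of variables by the stack move**: `∫ F(Φ_g U) ∏dg = ∫ F(U) ∏dg`. [cite: Kanazawa2008, §2 Lemma 1 eq. (11)] -/
theorem integral_comp_stackMul {L : ℕ} [NeZero L] {E : Type*} [NormedAddCommGroup E] [NormedSpace ℝ E] (i : Fin d) (g : G)
    (F : Config d L₀ L G → E) :
    ∫ U, F (stackMul i g U) ∂haar d L₀ L G = ∫ U, F U ∂haar d L₀ L G := by
  have h1 : Function.LeftInverse (stackMul (d := d) (L₀ := L₀) (L := L) i g⁻¹) (stackMul i g) := fun U => by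
    rw [stackMul_stackMul, inv_mul_cancel, stackMul_one]
  have h2 : Function.RightInverse (stackMul (d := d) (L₀ := L₀) (L := L) i g⁻¹) (stackMul i g) := fun U => by
    rw [stackMul_stackMul, mul_inv_cancel, stackMul_one]
  let e : Config d L₀ L G ≃ᵐ Config d L₀ L G :=
    { toFun := stackMul i g, invFun := stackMul i g⁻¹, left_inv := h1, right_inv := h2,
      measurable_toFun := (measurePreserving_stackMul i g).measurable,
      measurable_invFun := (measurePreserving_stackMul i g⁻¹).measurable }
  have hmp : MeasurePreserving e (haar d L₀ L G) (haar d L₀ L G) := measurePreserving_stackMul i g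
  exact hmp.integral_comp' F

omit [CompactSpace G] [MeasurableSpace G] [BorelSpace G] [NeZero L₀] in
/-- The stack twist is a continuous function of the configuration. [cite: Kanazawa2008, §2 eq. (12)] -/
theorem continuous_elecStackDiff {L : ℕ} [NeZero L] (hρ : Continuous ρ) (z : G) (i : Fin d) (c : ZMod L) :
    Continuous fun U : Config d L₀ L G => elecStackDiff ρ z i c U := by
  unfold elecStackDiff
  refine continuous_finsetSum _ fun y _ => ?_
  split_ifs
  · exact (Complex.continuous_re.comp ((Continuous.matrix_trace (hρ.comp (continuous_const.mul
      (continuous_plaquette _ _ _))) ))).sub (Complex.continuous_re.comp (Continuous.matrix_trace (hρ.comp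
        (continuous_plaquette _ _ _))))
  · exact continuous_const

omit [CompactSpace G] [MeasurableSpace G] [BorelSpace G] [NeZero L₀] in
/-- The twist observable is continuous. [cite: Kanazawa2008, §2 eq. (12)] -/
theorem continuous_stackTwistObs {L : ℕ} [NeZero L] (hρ : Continuous ρ) (JE : ℝ) (z : G) (i : Fin d) (c : ZMod L) :
    Continuous fun U : Config d L₀ L G => stackTwistObs ρ JE z i c U :=
  Real.continuous_exp.comp (continuous_const.mul (continuous_elecStackDiff ρ hρ z i c))

omit [TopologicalSpace G] [IsTopologicalGroup G] [CompactSpace G] [MeasurableSpace G] [BorelSpace G] in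
/-- **The twist on the stack `x_i = -1` lives in the closed positive half** of the site reflection in the direction `i`
(`L = 2n + 2`, `n ≥ 1`): its plaquettes use the links of the slice `x_i = -1` and the time-like links of the plane `x_i = 0`.
[cite: TomboulisYaffe1985, App. I §C (A1.8)] -/
theorem dependsOn_elecStackDiff_neg_one (hn : 1 ≤ n) (z : G) (i : Fin d) :
    DependsOn (fun U : Config d L₀ (2 * n + 2) G => elecStackDiff ρ z i (-1) U)
      ((sitePos d L₀ n i ∪ ∅ ∪ siteShared d L₀ n i : Finset _) : Set _) := by
  intro U V hUV
  unfold elecStackDiff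
  refine Finset.sum_congr rfl fun y _ => ?_
  by_cases hy : y i = -1
  · have hval : (-(y i)).val = 1 := by
      rw [hy, neg_neg, ← Nat.cast_one, ZMod.val_cast_of_lt (by omega)]
    have hP : plaquette U (0, y) none (some i) = plaquette V (0, y) none (some i) := by
      unfold plaquette
      have h1 : U (((0 : ZMod L₀), y), none) = V (((0 : ZMod L₀), y), none) :=
        hUV _ (Finset.mem_coe.2 (Finset.mem_union_left _ (Finset.mem_union_left _
          (mem_sitePos_of_val (by rw [hval]) (by rw [hval]; exact hn)))))
      have h2 : U (Site.shift ((0 : ZMod L₀), y) none, some i) = V (Site.shift ((0 : ZMod L₀), y) none, some i) :=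
        hUV _ (Finset.mem_coe.2 (Finset.mem_union_left _ (Finset.mem_union_left _
          (mem_sitePos_of_val (by simp only [Site.shift]; rw [hval]) (by simp only [Site.shift]; rw [hval]; exact hn)))))
      have h3 : U (Site.shift ((0 : ZMod L₀), y) (some i), none) = V (Site.shift ((0 : ZMod L₀), y) (some i), none) :=
        hUV _ (Finset.mem_coe.2 (Finset.mem_union_right _ (mem_siteShared_of (by simp) (Or.inl (by
          simp only [Site.shift, Pi.add_apply, Pi.single_eq_same]; rw [hy]; ring)))))
      have h4 : U (((0 : ZMod L₀), y), some i) = V (((0 : ZMod L₀), y), some i) :=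
        hUV _ (Finset.mem_coe.2 (Finset.mem_union_left _ (Finset.mem_union_left _
          (mem_sitePos_of_val (by rw [hval]) (by rw [hval]; exact hn)))))
      rw [h1, h2, h3, h4]
    rw [hP]
  · rw [if_neg hy, if_neg hy]

end Measure

/-! ### TY (A1.8): the Polyakov pair at separation `L_s/2` against the twist -/

section Bound

variable {d L₀ n : ℕ} [NeZero L₀] {G : Type*} [Group G] [TopologicalSpace G] [IsTopologicalGroup G]
  [CompactSpace G] [MeasurableSpace G] [BorelSpace G] [SecondCountableTopology G] {N : ℕ}
variable (ρ : G →* Matrix (Fin N) (Fin N) ℂ)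

/-- `-1 ≠ 0` in `ℤ/(2n+2)` (plumbing). [folklore] -/
private theorem neg_one_ne_zero_even : (-1 : ZMod (2 * n + 2)) ≠ 0 := by
  haveI : Fact (1 < 2 * n + 2) := ⟨by omega⟩
  rw [ne_eq, neg_eq_zero]; exact one_ne_zero

omit [SecondCountableTopology G] in
/-- **The twisted partition function does not depend on the position of the stack**: `∫ T_{-1,z} e^{-S} = ∫ T_{0,z} e^{-S}` (the stack
move `Φ_z`; central `z`). [cite: Kanazawa2008, §2 Lemma 1 eq. (11)] [cite: TomboulisYaffe1985, App. I §C (A1.8)] -/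
theorem integral_stackTwistObs_neg_one_eq (JE JM : ℝ) (i : Fin d) {z : G} (hz : z ∈ Subgroup.center G) :
    ∫ U, stackTwistObs ρ JE z i (-1) U * weight ρ JE JM U ∂haar d L₀ (2 * n + 2) G =
      ∫ U, stackTwistObs ρ JE z i 0 U * weight ρ JE JM U ∂haar d L₀ (2 * n + 2) G := by
  rw [← integral_comp_stackMul i z (fun U => stackTwistObs ρ JE z i (-1) U * weight ρ JE JM U)]
  refine integral_congr_ae (Eventually.of_forall fun U => ?_)
  dsimp only
  have h := weight_mul_twist_stackMul ρ neg_one_ne_zero_even JE JM i (z₀ := 1) (z₁ := z) hz U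
  rw [stackTwistObs_one, mul_one, one_mul, mul_inv_cancel, stackTwistObs_one, mul_one] at h
  rw [mul_comm, h, mul_comm]

omit [SecondCountableTopology G] in
/-- **Moving the stack across a Polyakov loop multiplies its trace by the centre character**: for central `z` with `ρ(z) = ω·1`,
`x₀` in the plane `x_i = 0` and `x₁` off it,
`∫ tr ρ(P_{x₀}) conj tr ρ(P_{x₁}) T_{0,z} e^{-S} = conj ω · ∫ tr ρ(P_{x₀}) conj tr ρ(P_{x₁}) T_{-1,z} e^{-S}` (the change of variables
`Φ_{z⁻¹}` "which flips the signs of the set of timelike links"). [cite: TomboulisYaffe1985, App. I §C (A1.8)] -/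
theorem integral_polyakov_pair_twist_zero_eq (hρu : ∀ g, ρ g ∈ Matrix.unitaryGroup (Fin N) ℂ) (JE JM : ℝ) (i : Fin d) {z : G}
    (hz : z ∈ Subgroup.center G) {ω : ℂ} (hω : ρ z = ω • (1 : Matrix (Fin N) (Fin N) ℂ)) {x₀ x₁ : Fin d → ZMod (2 * n + 2)}
    (hx₀ : x₀ i = 0) (hx₁ : x₁ i ≠ 0) :
    ∫ U, polyakovTrace ρ U x₀ * conj (polyakovTrace ρ U x₁) * (stackTwistObs ρ JE z i 0 U * weight ρ JE JM U : ℝ)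
        ∂haar d L₀ (2 * n + 2) G =
      conj ω * ∫ U, polyakovTrace ρ U x₀ * conj (polyakovTrace ρ U x₁) *
        (stackTwistObs ρ JE z i (-1) U * weight ρ JE JM U : ℝ) ∂haar d L₀ (2 * n + 2) G := by
  rw [← integral_const_mul, ← integral_comp_stackMul i z⁻¹ (fun U => polyakovTrace ρ U x₀ * conj (polyakovTrace ρ U x₁) *
    (stackTwistObs ρ JE z i 0 U * weight ρ JE JM U : ℝ))]
  refine integral_congr_ae (Eventually.of_forall fun U => ?_)
  dsimp only
  have hzi : z⁻¹ ∈ Subgroup.center G := Subgroup.inv_mem _ hz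
  have h := weight_mul_twist_stackMul ρ neg_one_ne_zero_even JE JM i (z₀ := z) (z₁ := 1) hzi U
  rw [stackTwistObs_one, mul_one, mul_inv_cancel, inv_inv, one_mul, stackTwistObs_one, mul_one] at h
  have hρinv : ρ z⁻¹ = conj ω • (1 : Matrix (Fin N) (Fin N) ℂ) := by
    rw [rep_inv_eq_star ρ hρu, hω, star_smul, star_one, Complex.star_def]
  have hP₀ : polyakovTrace ρ (stackMul i z⁻¹ U) x₀ = conj ω * polyakovTrace ρ U x₀ := by
    unfold polyakovTrace
    rw [polyakovLine_stackMul_of_eq i z⁻¹ U hx₀, map_mul, hρinv, smul_mul_assoc, one_mul, Matrix.trace_smul, smul_eq_mul]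
  have hP₁ : polyakovTrace ρ (stackMul i z⁻¹ U) x₁ = polyakovTrace ρ U x₁ := by
    unfold polyakovTrace; rw [polyakovLine_stackMul_of_ne i z⁻¹ U hx₁]
  rw [hP₀, hP₁, mul_comm (stackTwistObs ρ JE z i 0 (stackMul i z⁻¹ U)) _, h]
  push_cast
  ring

omit [SecondCountableTopology G] in
/-- **Two opposite twists on adjacent stacks cancel**: `∫ T_{-1,z} T_{0,z⁻¹} e^{-S} = Z` (the stack move `Φ_z`; central `z`).
[cite: Kanazawa2008, §2 Lemma 1 eq. (11)] -/
theorem integral_stackTwistObs_mul_inv_eq (JE JM : ℝ) (i : Fin d) {z : G} (hz : z ∈ Subgroup.center G) :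
    ∫ U, stackTwistObs ρ JE z i (-1) U * stackTwistObs ρ JE z⁻¹ i 0 U * weight ρ JE JM U ∂haar d L₀ (2 * n + 2) G =
      ∫ U, weight ρ JE JM U ∂haar d L₀ (2 * n + 2) G := by
  rw [← integral_comp_stackMul i z (fun U => stackTwistObs ρ JE z i (-1) U * stackTwistObs ρ JE z⁻¹ i 0 U * weight ρ JE JM U)]
  refine integral_congr_ae (Eventually.of_forall fun U => ?_)
  dsimp only
  have h := weight_mul_twist_stackMul ρ neg_one_ne_zero_even JE JM i (z₀ := z⁻¹) (z₁ := z) hz U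
  rw [inv_mul_cancel, mul_inv_cancel, stackTwistObs_one, stackTwistObs_one, mul_one, mul_one] at h
  rw [← h]; ring

/-- **★★ The Cauchy–Schwarz step of TY (A1.8) at finite temperature.**  For `L_s = 2n + 2 ≥ 4`, a continuous unitary `ρ`, any real
`J_E, J_M`, a direction `i`, a central `z`, and sites `x₀`, `x₁` of the lattice planes `x_i = 0`, `x_i = L_s/2`:
`|∫ tr ρ(P_{x₀}) conj tr ρ(P_{x₁}) (1 - T_{-1,z}) e^{-S}|² ≤ 2 N⁴ · Z · (Z - ∫ T_{0,z} e^{-S})`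
(reflection positivity in the planes containing the two loops, "considering both traces of the twist to be on opposite sides
of the lattice from `τ[S]`"; the form on `1 - T_{-1,z}` equals `2(Z - Z⁻)` by the cancellation of opposite twists).
[cite: TomboulisYaffe1985, App. I §C eq. (A1.8) (p. 339)] [cite: Kanazawa2008, §2 Lemma 2 eqs. (15)–(17)] -/
theorem normSq_integral_polyakov_pair_mul_one_sub_twist_le (hρu : ∀ g, ρ g ∈ Matrix.unitaryGroup (Fin N) ℂ)
    (hρ : Continuous ρ) (hn : 1 ≤ n) (JE JM : ℝ) (i : Fin d) {z : G} (hz : z ∈ Subgroup.center G)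
    {x₀ x₁ : Fin d → ZMod (2 * n + 2)} (hx₀ : x₀ i = 0) (hx₁ : x₁ i = ((n + 1 : ℕ) : ZMod (2 * n + 2))) :
    ‖∫ U, polyakovTrace ρ U x₀ * conj (polyakovTrace ρ U x₁) * ((1 - stackTwistObs ρ JE z i (-1) U) * weight ρ JE JM U : ℝ)
        ∂haar d L₀ (2 * n + 2) G‖ ^ 2 ≤
      2 * (N : ℝ) ^ 4 * (∫ U, weight ρ JE JM U ∂haar d L₀ (2 * n + 2) G) *
        ((∫ U, weight ρ JE JM U ∂haar d L₀ (2 * n + 2) G) -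
          ∫ U, stackTwistObs ρ JE z i 0 U * weight ρ JE JM U ∂haar d L₀ (2 * n + 2) G) := by
  -- the family: `F = 1 - T_{-1,z}` (positive half), `E = conj tr P_{x₀} · tr P_{x₁}` (in the planes)
  set F : Unit → Config d L₀ (2 * n + 2) G → ℂ := fun _ U => ((1 - stackTwistObs ρ JE z i (-1) U : ℝ) : ℂ) with hF
  set E : Unit → Config d L₀ (2 * n + 2) G → ℂ := fun _ U => conj (polyakovTrace ρ U x₀) * polyakovTrace ρ U x₁ with hE
  have hTc := continuous_stackTwistObs (d := d) (L₀ := L₀) ρ hρ JE z i (-1 : ZMod (2 * n + 2))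
  obtain ⟨KT, hKT⟩ := exists_forall_norm_le_of_continuous (L := 2 * n + 2) hTc
  have hFm : ∀ k, Measurable (F k) := fun _ => (Complex.continuous_ofReal.comp (continuous_const.sub hTc)).measurable
  have hEm : ∀ k, Measurable (E k) := fun _ =>
    ((Complex.continuous_conj.comp (continuous_polyakovTrace ρ hρ _)).mul (continuous_polyakovTrace ρ hρ _)).measurable
  have hFb : ∀ k U, ‖F k U‖ ≤ 1 + KT := fun _ U => by
    simp only [hF, Complex.norm_real, Real.norm_eq_abs]
    calc |1 - stackTwistObs ρ JE z i (-1) U| ≤ |(1 : ℝ)| + |stackTwistObs ρ JE z i (-1) U| := abs_sub _ _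
      _ ≤ 1 + KT := by rw [abs_one]; exact add_le_add le_rfl ((Real.norm_eq_abs _).symm.le.trans (hKT U))
  have hEb : ∀ k U, ‖E k U‖ ≤ N * N := fun _ U => by
    simp only [hE, norm_mul, Complex.norm_conj]
    exact mul_le_mul (norm_trace_le_of_mem_unitaryGroup (hρu _)) (norm_trace_le_of_mem_unitaryGroup (hρu _))
      (norm_nonneg _) (Nat.cast_nonneg _)
  have hFd : ∀ k, DependsOn (F k) ((sitePos d L₀ n i ∪ ∅ ∪ siteShared d L₀ n i : Finset _) : Set _) := fun _ U V hUV => by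
    show (((1 - stackTwistObs ρ JE z i (-1) U : ℝ) : ℂ)) = ((1 - stackTwistObs ρ JE z i (-1) V : ℝ) : ℂ)
    unfold stackTwistObs
    rw [show elecStackDiff ρ z i (-1) U = elecStackDiff ρ z i (-1) V from dependsOn_elecStackDiff_neg_one ρ hn z i hUV]
  have hx₁' : siteRefl i x₁ = x₁ := by
    funext j; by_cases hj : j = i
    · subst hj; rw [siteRefl_apply_same, hx₁, neg_half]
    · simp [hj]
  have hx₀' : siteRefl i x₀ = x₀ := by
    funext j; by_cases hj : j = i
    · subst hj; simp [hx₀]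
    · simp [hj]
  have hEd : ∀ k, DependsOn (E k) ((sitePos d L₀ n i ∪ ∅ ∪ siteShared d L₀ n i : Finset _) : Set _) := fun _ U V hUV => by
    show conj (polyakovTrace ρ U x₀) * polyakovTrace ρ U x₁ = conj (polyakovTrace ρ V x₀) * polyakovTrace ρ V x₁
    rw [show polyakovTrace ρ U x₀ = polyakovTrace ρ V x₀ from dependsOn_polyakovTrace_plane ρ i hx₀ hUV,
      show polyakovTrace ρ U x₁ = polyakovTrace ρ V x₁ from
        dependsOn_polyakovTrace_site ρ i (s := n + 1) (by omega) le_rfl (by rw [hx₁, neg_half]) hUV]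
  have hCS := site_osForm_normSq_le ρ hρu hρ hn JE JM i F E hFm hEm hFb hEb hFd hEd
  have hpos := site_osForm_self_nonneg ρ hρu hρ hn JE JM i F hFm hFb hFd
  -- identify the three forms
  have hσE : ∀ U, E () (spaceSiteReflect i U) = E () U := fun U => by
    simp only [hE, polyakovTrace_spaceSiteReflect, hx₀', hx₁']
  have hσF : ∀ U, F () (spaceSiteReflect i U) = ((1 - stackTwistObs ρ JE z⁻¹ i 0 U : ℝ) : ℂ) := fun U => by
    simp only [hF, stackTwistObs_spaceSiteReflect ρ hρu JE i hz]
    norm_num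
  have hFE : ∑ k, ∫ U, F k U * conj (E k (spaceSiteReflect i U)) * (weight ρ JE JM U : ℂ) ∂haar d L₀ (2 * n + 2) G =
      ∫ U, polyakovTrace ρ U x₀ * conj (polyakovTrace ρ U x₁) * ((1 - stackTwistObs ρ JE z i (-1) U) * weight ρ JE JM U : ℝ)
        ∂haar d L₀ (2 * n + 2) G := by
    rw [Fintype.sum_unique]
    refine integral_congr_ae (Eventually.of_forall fun U => ?_)
    change F () U * conj (E () (spaceSiteReflect i U)) * _ = _
    rw [hσE]
    simp only [hF, hE, map_mul, Complex.conj_conj]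
    push_cast; ring
  -- `B(F,F) = 2 (Z - Z⁻)`
  have hw := continuous_weight (d := d) (L₀ := L₀) (L := 2 * n + 2) ρ hρ JE JM
  have hiT : ∀ (c : ZMod (2 * n + 2)) (y : G), Integrable (fun U => stackTwistObs ρ JE y i c U * weight ρ JE JM U)
      (haar d L₀ (2 * n + 2) G) := fun c y =>
    integrable_of_continuous ((continuous_stackTwistObs ρ hρ JE y i c).mul hw)
  have hiTT : Integrable (fun U => stackTwistObs ρ JE z i (-1) U * stackTwistObs ρ JE z⁻¹ i 0 U * weight ρ JE JM U)
      (haar d L₀ (2 * n + 2) G) :=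
    integrable_of_continuous (((continuous_stackTwistObs ρ hρ JE z i _).mul (continuous_stackTwistObs ρ hρ JE z⁻¹ i _)).mul hw)
  have hR' : ∫ U, stackTwistObs ρ JE z⁻¹ i 0 U * weight ρ JE JM U ∂haar d L₀ (2 * n + 2) G =
      ∫ U, stackTwistObs ρ JE z i 0 U * weight ρ JE JM U ∂haar d L₀ (2 * n + 2) G := by
    rw [← integral_stackTwistObs_neg_one_eq ρ JE JM i hz, ← integral_comp_spaceSiteReflect' i
      (fun U => stackTwistObs ρ JE z i (-1) U * weight ρ JE JM U)]
    refine integral_congr_ae (Eventually.of_forall fun U => ?_)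
    dsimp only
    rw [stackTwistObs_spaceSiteReflect ρ hρu JE i hz, TomboulisYaffeHighTemperature.weight_spaceSiteReflect ρ hρu]
    norm_num
  have hFF : ∑ k, ∫ U, F k U * conj (F k (spaceSiteReflect i U)) * (weight ρ JE JM U : ℂ) ∂haar d L₀ (2 * n + 2) G =
      ((2 * ((∫ U, weight ρ JE JM U ∂haar d L₀ (2 * n + 2) G) -
        ∫ U, stackTwistObs ρ JE z i 0 U * weight ρ JE JM U ∂haar d L₀ (2 * n + 2) G) : ℝ) : ℂ) := by
    rw [Fintype.sum_unique]
    have hpt : ∀ U, F () U * conj (F () (spaceSiteReflect i U)) * (weight ρ JE JM U : ℂ) =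
        ((weight ρ JE JM U - stackTwistObs ρ JE z i (-1) U * weight ρ JE JM U -
          stackTwistObs ρ JE z⁻¹ i 0 U * weight ρ JE JM U +
            stackTwistObs ρ JE z i (-1) U * stackTwistObs ρ JE z⁻¹ i 0 U * weight ρ JE JM U : ℝ) : ℂ) := by
      intro U
      rw [hσF]; simp only [hF, Complex.conj_ofReal]; push_cast; ring
    simp_rw [hpt]
    rw [integral_complex_ofReal, integral_add, integral_sub, integral_sub, integral_stackTwistObs_neg_one_eq ρ JE JM i hz,
      hR', integral_stackTwistObs_mul_inv_eq ρ JE JM i hz]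
    · push_cast; ring
    · exact integrable_of_continuous hw
    · exact hiT _ _
    · exact (integrable_of_continuous hw).sub (hiT _ _)
    · exact hiT _ _
    · exact ((integrable_of_continuous hw).sub (hiT _ _)).sub (hiT _ _)
    · exact hiTT
  -- `B(E,E) ≤ N⁴ Z`
  have hEE : (∑ k, ∫ U, E k U * conj (E k (spaceSiteReflect i U)) * (weight ρ JE JM U : ℂ) ∂haar d L₀ (2 * n + 2) G).re ≤
      (N : ℝ) ^ 4 * ∫ U, weight ρ JE JM U ∂haar d L₀ (2 * n + 2) G := by
    rw [Fintype.sum_unique]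
    have hpt : ∀ U, E () U * conj (E () (spaceSiteReflect i U)) * (weight ρ JE JM U : ℂ) =
        ((‖E () U‖ ^ 2 * weight ρ JE JM U : ℝ) : ℂ) := by
      intro U
      rw [hσE, Complex.mul_conj, Complex.normSq_eq_norm_sq]; push_cast; ring
    simp_rw [hpt]
    rw [integral_complex_ofReal, Complex.ofReal_re, ← integral_const_mul]
    refine integral_mono_of_nonneg (Eventually.of_forall fun U => mul_nonneg (sq_nonneg _) (weight_pos ρ JE JM U).le)
      ((integrable_of_continuous hw).const_mul _) (Eventually.of_forall fun U => ?_)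
    refine mul_le_mul_of_nonneg_right ?_ (weight_pos ρ JE JM U).le
    calc ‖E () U‖ ^ 2 ≤ ((N : ℝ) * N) ^ 2 := pow_le_pow_left₀ (norm_nonneg _) (hEb () U) 2
      _ = (N : ℝ) ^ 4 := by ring
  rw [hFE, hFF, Complex.ofReal_re] at hCS
  rw [hFF] at hpos
  have hZR : 0 ≤ 2 * ((∫ U, weight ρ JE JM U ∂haar d L₀ (2 * n + 2) G) -
      ∫ U, stackTwistObs ρ JE z i 0 U * weight ρ JE JM U ∂haar d L₀ (2 * n + 2) G) := by
    exact_mod_cast (Complex.nonneg_iff.1 hpos).1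
  calc _ ≤ _ := hCS
    _ ≤ (2 * ((∫ U, weight ρ JE JM U ∂haar d L₀ (2 * n + 2) G) -
          ∫ U, stackTwistObs ρ JE z i 0 U * weight ρ JE JM U ∂haar d L₀ (2 * n + 2) G)) *
          ((N : ℝ) ^ 4 * ∫ U, weight ρ JE JM U ∂haar d L₀ (2 * n + 2) G) := mul_le_mul_of_nonneg_left hEE hZR
    _ = _ := by ring

/-- **The twisted partition function is at most the untwisted one**: `∫ T_{0,z} e^{-S} ≤ Z` (central `z`; Kanazawa's
`0 ≤ ⟨𝒪^{[k]}[𝒱]⟩ ≤ 1` at finite temperature, a by-product of the positivity of the form on `1 - T_{-1,z}`).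
[cite: Kanazawa2008, §2 Lemma 2 eq. (17)] -/
theorem integral_stackTwistObs_mul_weight_le (hρu : ∀ g, ρ g ∈ Matrix.unitaryGroup (Fin N) ℂ) (hρ : Continuous ρ)
    (hn : 1 ≤ n) (JE JM : ℝ) (i : Fin d) {z : G} (hz : z ∈ Subgroup.center G) :
    ∫ U, stackTwistObs ρ JE z i 0 U * weight ρ JE JM U ∂haar d L₀ (2 * n + 2) G ≤
      ∫ U, weight ρ JE JM U ∂haar d L₀ (2 * n + 2) G := by
  have h := normSq_integral_polyakov_pair_mul_one_sub_twist_le (L₀ := L₀) ρ hρu hρ hn JE JM i hz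
    (x₀ := fun _ => 0) (x₁ := fun _ => ((n + 1 : ℕ) : ZMod (2 * n + 2))) rfl rfl
  have hZ : 0 < ∫ U, weight ρ JE JM U ∂haar d L₀ (2 * n + 2) G := partitionFunction_pos ρ hρ JE JM
  have h0 : 0 ≤ 2 * (N : ℝ) ^ 4 * (∫ U, weight ρ JE JM U ∂haar d L₀ (2 * n + 2) G) *
      ((∫ U, weight ρ JE JM U ∂haar d L₀ (2 * n + 2) G) -
        ∫ U, stackTwistObs ρ JE z i 0 U * weight ρ JE JM U ∂haar d L₀ (2 * n + 2) G) := (sq_nonneg _).trans h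
  by_cases hN : N = 0
  · -- `N = 0`: `ρ` is the zero-dimensional representation, `T = 1`
    have hT : ∀ U : Config d L₀ (2 * n + 2) G, stackTwistObs ρ JE z i 0 U = 1 := by
      intro U; subst hN
      unfold stackTwistObs elecStackDiff
      simp [Matrix.trace]
    simp_rw [hT, one_mul]; exact le_rfl
  · have hN4 : 0 < 2 * (N : ℝ) ^ 4 * ∫ U, weight ρ JE JM U ∂haar d L₀ (2 * n + 2) G := by
      have : 0 < (N : ℝ) := by exact_mod_cast Nat.pos_of_ne_zero hN
      positivity
    nlinarith

/-- **★★★ TY (A1.8) at finite temperature — the Polyakov pair at separation `L_s/2` is bounded by the twist.**  On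
`ℤ_{L_t} × (ℤ/L_s)^d` with `L_s = 2n + 2 ≥ 4`, for a continuous unitary `ρ`, any real `J_E, J_M`, a direction `i`, a central `z`
acting in `ρ` as the scalar `ω` (`|ω| = 1`), and sites `x₀`, `x₁` of the lattice planes `x_i = 0`, `x_i = L_s/2`:
`|1 - ω|² · |∫ tr ρ(P_{x₀}) conj tr ρ(P_{x₁}) e^{-S}|² ≤ 8 N⁴ · Z · (Z - Z⁻_z)`, `Z⁻_z = ∫ T_{0,z} e^{-S}` the twisted partition function —
i.e. `|1 - ω|² |G(x₀, x₁)|² ≤ 8 N⁴ (1 - Z⁻_z/Z)`; for `ω = -1` this is (A1.8) `G_{L_s/2}² ≤ 4 · ½(1 - Z⁻/Z)` with un-normalised traces.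
("insert `1 = ½(1 - τ[S]) + ½(1 + τ[S])` … make a change of variables which flips the signs of the set of timelike links … apply
reflection positivity using a reflection which leaves invariant the planes containing `Ω[0]` and `Ω[x]`.")
[cite: TomboulisYaffe1985, App. I §C eq. (A1.8) (p. 339)] [cite: Kanazawa2008, §2 Lemma 2 eqs. (15)–(18)] -/
theorem normSq_integral_polyakov_pair_le_twist (hρu : ∀ g, ρ g ∈ Matrix.unitaryGroup (Fin N) ℂ) (hρ : Continuous ρ)
    (hn : 1 ≤ n) (JE JM : ℝ) (i : Fin d) {z : G} (hz : z ∈ Subgroup.center G) {ω : ℂ}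
    (hω : ρ z = ω • (1 : Matrix (Fin N) (Fin N) ℂ)) (hω1 : ‖ω‖ = 1) {x₀ x₁ : Fin d → ZMod (2 * n + 2)} (hx₀ : x₀ i = 0)
    (hx₁ : x₁ i = ((n + 1 : ℕ) : ZMod (2 * n + 2))) :
    ‖1 - ω‖ ^ 2 * ‖∫ U, polyakovTrace ρ U x₀ * conj (polyakovTrace ρ U x₁) * (weight ρ JE JM U : ℂ) ∂haar d L₀ (2 * n + 2) G‖ ^ 2 ≤
      8 * (N : ℝ) ^ 4 * (∫ U, weight ρ JE JM U ∂haar d L₀ (2 * n + 2) G) *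
        ((∫ U, weight ρ JE JM U ∂haar d L₀ (2 * n + 2) G) -
          ∫ U, stackTwistObs ρ JE z i 0 U * weight ρ JE JM U ∂haar d L₀ (2 * n + 2) G) := by
  have hzi : z⁻¹ ∈ Subgroup.center G := Subgroup.inv_mem _ hz
  have hx₁0 : x₁ i ≠ 0 := by
    rw [hx₁]; intro h
    have := congrArg ZMod.val h
    rw [val_natCast_half, ZMod.val_zero] at this
    omega
  set Z : ℝ := ∫ U, weight ρ JE JM U ∂haar d L₀ (2 * n + 2) G with hZ
  set R : ℝ := ∫ U, stackTwistObs ρ JE z i 0 U * weight ρ JE JM U ∂haar d L₀ (2 * n + 2) G with hR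
  set X : ℂ := ∫ U, polyakovTrace ρ U x₀ * conj (polyakovTrace ρ U x₁) * (weight ρ JE JM U : ℂ)
    ∂haar d L₀ (2 * n + 2) G with hX
  -- `a`: the stack at `0`, `b`: the stack at `-1`
  set a : ℂ := ∫ U, polyakovTrace ρ U x₀ * conj (polyakovTrace ρ U x₁) *
    ((1 - stackTwistObs ρ JE z i 0 U) * weight ρ JE JM U : ℝ) ∂haar d L₀ (2 * n + 2) G with ha
  set b : ℂ := ∫ U, polyakovTrace ρ U x₀ * conj (polyakovTrace ρ U x₁) *
    ((1 - stackTwistObs ρ JE z i (-1) U) * weight ρ JE JM U : ℝ) ∂haar d L₀ (2 * n + 2) G with hb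
  have hw := continuous_weight (d := d) (L₀ := L₀) (L := 2 * n + 2) ρ hρ JE JM
  have hPc : Continuous fun U : Config d L₀ (2 * n + 2) G => polyakovTrace ρ U x₀ * conj (polyakovTrace ρ U x₁) :=
    (continuous_polyakovTrace ρ hρ _).mul (Complex.continuous_conj.comp (continuous_polyakovTrace ρ hρ _))
  have hint : ∀ f : Config d L₀ (2 * n + 2) G → ℝ, Continuous f → Integrable (fun U =>
      polyakovTrace ρ U x₀ * conj (polyakovTrace ρ U x₁) * (f U : ℂ)) (haar d L₀ (2 * n + 2) G) := fun f hf =>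
    (hPc.mul (Complex.continuous_ofReal.comp hf)).integrable_of_hasCompactSupport
      (HasCompactSupport.of_compactSpace _)
  -- `(1 - conj ω) X = a - conj ω · b`
  have hmove := integral_polyakov_pair_twist_zero_eq (L₀ := L₀) ρ hρu JE JM i hz hω hx₀ hx₁0
  have hkey : (1 - conj ω) * X = a - conj ω * b := by
    have ha' : a = X - ∫ U, polyakovTrace ρ U x₀ * conj (polyakovTrace ρ U x₁) *
        (stackTwistObs ρ JE z i 0 U * weight ρ JE JM U : ℝ) ∂haar d L₀ (2 * n + 2) G := by
      rw [ha, hX, ← integral_sub (hint _ hw) (hint (fun U => stackTwistObs ρ JE z i 0 U * weight ρ JE JM U)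
        ((continuous_stackTwistObs ρ hρ JE z i 0).mul hw))]
      refine integral_congr_ae (Eventually.of_forall fun U => ?_)
      push_cast; ring
    have hb' : b = X - ∫ U, polyakovTrace ρ U x₀ * conj (polyakovTrace ρ U x₁) *
        (stackTwistObs ρ JE z i (-1) U * weight ρ JE JM U : ℝ) ∂haar d L₀ (2 * n + 2) G := by
      rw [hb, hX, ← integral_sub (hint _ hw) (hint (fun U => stackTwistObs ρ JE z i (-1) U * weight ρ JE JM U)
        ((continuous_stackTwistObs ρ hρ JE z i (-1)).mul hw))]
      refine integral_congr_ae (Eventually.of_forall fun U => ?_)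
      push_cast; ring
    rw [ha', hb', hmove]; ring
  -- the bound for `b`
  have hb2 : ‖b‖ ^ 2 ≤ 2 * (N : ℝ) ^ 4 * Z * (Z - R) :=
    normSq_integral_polyakov_pair_mul_one_sub_twist_le (L₀ := L₀) ρ hρu hρ hn JE JM i hz hx₀ hx₁
  -- the bound for `a`: reflect, then the same bound for `z⁻¹`
  have hx₁' : siteRefl i x₁ = x₁ := by
    funext j; by_cases hj : j = i
    · subst hj; rw [siteRefl_apply_same, hx₁, neg_half]
    · simp [hj]
  have hx₀' : siteRefl i x₀ = x₀ := by
    funext j; by_cases hj : j = i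
    · subst hj; simp [hx₀]
    · simp [hj]
  have ha_eq : a = ∫ U, polyakovTrace ρ U x₀ * conj (polyakovTrace ρ U x₁) *
      ((1 - stackTwistObs ρ JE z⁻¹ i (-1) U) * weight ρ JE JM U : ℝ) ∂haar d L₀ (2 * n + 2) G := by
    rw [ha, ← integral_comp_spaceSiteReflect' i (fun U => polyakovTrace ρ U x₀ * conj (polyakovTrace ρ U x₁) *
      ((1 - stackTwistObs ρ JE z i 0 U) * weight ρ JE JM U : ℝ))]
    refine integral_congr_ae (Eventually.of_forall fun U => ?_)
    dsimp only
    rw [polyakovTrace_spaceSiteReflect, polyakovTrace_spaceSiteReflect, hx₀', hx₁',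
      stackTwistObs_spaceSiteReflect ρ hρu JE i hz, TomboulisYaffeHighTemperature.weight_spaceSiteReflect ρ hρu]
    norm_num
  have hRinv : ∫ U, stackTwistObs ρ JE z⁻¹ i 0 U * weight ρ JE JM U ∂haar d L₀ (2 * n + 2) G = R := by
    rw [hR, ← integral_stackTwistObs_neg_one_eq ρ JE JM i hz, ← integral_comp_spaceSiteReflect' i
      (fun U => stackTwistObs ρ JE z i (-1) U * weight ρ JE JM U)]
    refine integral_congr_ae (Eventually.of_forall fun U => ?_)
    dsimp only
    rw [stackTwistObs_spaceSiteReflect ρ hρu JE i hz, TomboulisYaffeHighTemperature.weight_spaceSiteReflect ρ hρu]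
    norm_num
  have ha2 : ‖a‖ ^ 2 ≤ 2 * (N : ℝ) ^ 4 * Z * (Z - R) := by
    have h := normSq_integral_polyakov_pair_mul_one_sub_twist_le (L₀ := L₀) ρ hρu hρ hn JE JM i hzi hx₀ hx₁
    rw [hRinv] at h
    rw [ha_eq]; exact h
  -- combine
  have hnorm : ‖1 - ω‖ = ‖1 - conj ω‖ := by
    rw [← Complex.norm_conj (1 - ω), map_sub, map_one]
  have hZR : 0 ≤ Z - R := sub_nonneg.2 (integral_stackTwistObs_mul_weight_le (L₀ := L₀) ρ hρu hρ hn JE JM i hz)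
  calc ‖1 - ω‖ ^ 2 * ‖X‖ ^ 2 = ‖(1 - conj ω) * X‖ ^ 2 := by rw [norm_mul, hnorm, mul_pow]
    _ = ‖a - conj ω * b‖ ^ 2 := by rw [hkey]
    _ ≤ (‖a‖ + ‖b‖) ^ 2 := by
        refine pow_le_pow_left₀ (norm_nonneg _) ((norm_sub_le _ _).trans (le_of_eq ?_)) 2
        rw [norm_mul, Complex.norm_conj, hω1, one_mul]
    _ ≤ 2 * (‖a‖ ^ 2 + ‖b‖ ^ 2) := by nlinarith [norm_nonneg a, norm_nonneg b, sq_nonneg (‖a‖ - ‖b‖)]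
    _ ≤ 2 * (2 * (N : ℝ) ^ 4 * Z * (Z - R) + 2 * (N : ℝ) ^ 4 * Z * (Z - R)) := by linarith [ha2, hb2]
    _ = 8 * (N : ℝ) ^ 4 * Z * (Z - R) := by ring

end Bound

end FiniteTemperature

end Literature.Barriers.QuantumFields

end
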